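import Literature.NumberTheory.Weil1965.FibreMeasureSplitPlace
import Literature.NumberTheory.Weil1965.ThetaIntegralOrbitFunctionalSupport
import HarnessLib

/-!
# The THETA-SIDE fibre measures `μ̂_b = ν_{Λ_θ}|_{hNorm⁻¹(b)}` at a split place: the I-CLOSE inputs `hfin₁ ∧ hinv₁ ∧ hcar₁`

Topic `NumberTheory/Weil1965`; namespace `Literature.NumberTheory.Weil1965.UnitaryDoubling`.  KERNEL mathematics only (theorems;
no definition, no named fact, no `axiom`, no `sorry`).  The Θ-twin of ★ `AdelicSiegelFibreMeasureSplitPlaceWeighted ::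
map_adelicSiegelFibreMeasure_identityClose_hypotheses`: the INSTANCE of the generic split-place lemma ★ `FibreMeasureSplitPlace ::
map_fibreMeasure_identityClose_hypotheses` at the positive, `U(J_V)(𝔸)`-invariant theta-side orbit functional
`S := Λ_θ,ℝ = thetaOrbitFunctionalReal … ν` (★ `ThetaIntegralOrbitFunctionalUnitary`) and the hermitian norm `h := hNorm` — with
the functional-analytic letters DISCHARGED by the tree:

* positivity `hS` = ★ `thetaOrbitFunctionalReal_nonneg`; continuity `hh` = ★ `continuous_hNorm`;
* `hTh` (`hNorm ∘ A_h = hNorm`) = ★ `hNorm_vDiagAct`;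
* `hTS` (`𝒮 ∘ A_h ⊆ 𝒮`) = ★ `twist_actTwistGL` + ★ `twist_mem`;
* `hST` (`Λ_θ,ℝ(Ψ ∘ A_h) = Λ_θ,ℝ(Ψ)`, `ν` invariant) = ★ `orbitFunctionalReal_comp`,

for the isometries `T g := A_{sel g}`, `A = vDiagAct`, along any selector `sel : GL_κ(K) → U(J_V)(𝔸)`.  What remains are the
split-place chart letters of (BRIDGE-v)/(SPLIT-v) only: the frame `fr : X□(𝔸) ≃ (K^κ × K^κ) × Y`, `b`, `b'`, the fibre clause `hfib`
(`hNorm = b ⇒` max-rank split locus), the selector `sel` and its intertwining `hTe` (★ `Theorems/H413E2SWSplitPlaceFrame ::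
exists_splitPlaceFrame`, clauses (ii)–(iii)).  Heads: `map_fibreMeasure_thetaOrbitFunctionalReal_identityClose_hypotheses` (= the
`H₁` of ★ `Theorems/H413E2SWIdentityCloseFibre :: integral_fibreMeasure_eq_smul_of_splitPlaceFrame`), the weighted Lemme-22 form
`exists_lintegral_mul_weight_map_fibreMeasure_thetaOrbitFunctionalReal_eq_mul_fibreMeasure`, and rectangles.

Cell `hodgecm-mathlib`, FLOOR 0, crux H413 (stmt-HodgeConjecture-24833), E-2 ∕ SW2 I-CLOSE sheet c78afe1b §1, row (a′) of F0P4-plan (g4)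
2026-08-31 04:29:45Z.  HC_CM is proved only modulo the 7 printed citations until rung 0 closes; this file is unconditional.

## References
* [Weil1965] A. Weil, *Sur la formule de Siegel dans la théorie des groupes classiques*, Acta Math. 113 (1965): Chap. I n° 2
  Lemme 3 p. 7; Chap. IV n° 41 (35) p. 59, n° 45–46 pp. 64–66; Chap. V n° 49 Lemme 22 p. 70, n° 51–52 pp. 73–77.
-/

set_option autoImplicit false

noncomputable section

namespace Literature.NumberTheory.Weil1965.UnitaryDoubling

open Literature.NumberTheory.Automorphic Literature.NumberTheory.Weil1964 Literature.NumberTheory.Weil1965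
open NumberField IsDedekindDomain _root_.MeasureTheory Filter _root_.Topology Set
open scoped Matrix NNReal ENNReal

variable (F E : Type) [Field F] [NumberField F] [Field E] [NumberField E] [Algebra F E] [Algebra.IsQuadraticExtension F E]
  (c : E ≃ₐ[F] E) {δ : E} (hcδ : c δ = -δ) (hδ : δ ≠ 0) {d : F} (hd : δ * δ = algebraMap F E d)
  (N : ℕ) {n : ℕ} (e : Fin N × Fin 1 ≃ Fin n)
  (TV : Matrix (Fin N) (Fin N) F) (hV : TV.IsSymm) (hVd : IsUnit TV.det)
  (TW : Matrix (Fin 1) (Fin 1) F) (hW : TW.IsSymm) (hWd : IsUnit TW.det)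
  [LocallyCompactSpace (UnitaryGroup.adelic F E c N (TV.map (algebraMap F E)))]
  [CompactSpace (UnitaryGroup.adelic F E c N (TV.map (algebraMap F E)) ⧸ (UnitaryGroup.toAdelic F E c N (TV.map (algebraMap F E))).range)]
  [MeasurableSpace (UnitaryGroup.adelic F E c N (TV.map (algebraMap F E)) ⧸ (UnitaryGroup.toAdelic F E c N (TV.map (algebraMap F E))).range)]
  [BorelSpace (UnitaryGroup.adelic F E c N (TV.map (algebraMap F E)) ⧸ (UnitaryGroup.toAdelic F E c N (TV.map (algebraMap F E))).range)]
  (ν : Measure (UnitaryGroup.adelic F E c N (TV.map (algebraMap F E)) ⧸ (UnitaryGroup.toAdelic F E c N (TV.map (algebraMap F E))).range))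
  [IsFiniteMeasure ν]
  [SMulInvariantMeasure (UnitaryGroup.adelic F E c N (TV.map (algebraMap F E)))
    (UnitaryGroup.adelic F E c N (TV.map (algebraMap F E)) ⧸ (UnitaryGroup.toAdelic F E c N (TV.map (algebraMap F E))).range) ν]
  [MeasurableSpace (AdeleRing (𝓞 F) F)] [BorelSpace (AdeleRing (𝓞 F) F)]
  {K : Type*} [Field K] [ValuativeRel K] [TopologicalSpace K] [IsNonarchimedeanLocalField K]
  [MeasurableSpace K] [BorelSpace K] [MeasurableSingletonClass K] (μK : Measure K) [μK.IsAddHaarMeasure]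
  {κ : Type*} [Fintype κ] [Nonempty κ] [DecidableEq κ] (hκ : 2 ≤ Fintype.card κ)
  {Y : Type*} [TopologicalSpace Y] [T2Space Y] [MeasurableSpace Y] [BorelSpace Y] [SecondCountableTopology Y]
  (fr : (Fin (n + n) → AdeleRing (𝓞 F) F) ≃ₜ ((κ → K) × (κ → K)) × Y)
  (b : F) (b' : K)
  (hfib : ∀ x, hNorm F E c hcδ hδ N e TV hVd TW hWd x = algebraMap F (AdeleRing (𝓞 F) F) b →
    (fr x).1.1 ⬝ᵥ (fr x).1.2 = b' ∧ (fr x).1.1 ≠ 0 ∧ (fr x).1.2 ≠ 0)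
  (sel : GL κ K → UnitaryGroup.adelic F E c N (TV.map (algebraMap F E)))
  (hTe : ∀ g x, fr (vDiagAct F E c hcδ hδ hd N e TV hV hVd TW hW hWd (sel g) x) =
    ((((g : Matrix κ κ K) *ᵥ (fr x).1.1, ((g⁻¹ : GL κ K) : Matrix κ κ K)ᵀ *ᵥ (fr x).1.2) : (κ → K) × (κ → K)), (fr x).2))

omit [MeasurableSingletonClass K] [Nonempty κ] in
include hfib hTe in
/-- **THE I-CLOSE INPUTS OF THE THETA-SIDE FIBRE MEASURE AT A SPLIT PLACE** (`H₁` of ★ `integral_fibreMeasure_eq_smul_of_splitPlaceFrame`):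
`fr_* μ̂_b` is finite on compact rectangles, invariant on Borel rectangles under `(x, y) ↦ (g x, g⁻ᵀ y)` (`g ∈ GL_κ(K)`, realised by
`A_{sel g}`), and carried by `S_{b'} × Y`. [cite: Weil1965, Chap. IV n° 46, p. 66; n° 41 (35), p. 59; Chap. V n° 50, pp. 73–74] -/
theorem map_fibreMeasure_thetaOrbitFunctionalReal_identityClose_hypotheses :
    (∀ (L : Set ((κ → K) × (κ → K))) (B : Set Y), IsCompact L → IsCompact B →
      ((fibreMeasure F (Fin (n + n)) (thetaOrbitFunctionalReal F E c hcδ hδ hd N e TV hV hVd TW hW hWd ν)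
        (thetaOrbitFunctionalReal_nonneg F E c hcδ hδ hd N e TV hV hVd TW hW hWd ν)
        (hNorm F E c hcδ hδ N e TV hVd TW hWd) b).map fr) (L ×ˢ B) < ⊤) ∧
    (∀ (g : GL κ K) (A : Set ((κ → K) × (κ → K))) (B : Set Y), MeasurableSet A → MeasurableSet B →
      ((fibreMeasure F (Fin (n + n)) (thetaOrbitFunctionalReal F E c hcδ hδ hd N e TV hV hVd TW hW hWd ν)
        (thetaOrbitFunctionalReal_nonneg F E c hcδ hδ hd N e TV hV hVd TW hW hWd ν)
        (hNorm F E c hcδ hδ N e TV hVd TW hWd) b).map fr)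
        (((fun z => (((g : Matrix κ κ K) *ᵥ z.1, ((g⁻¹ : GL κ K) : Matrix κ κ K)ᵀ *ᵥ z.2) : (κ → K) × (κ → K))) ⁻¹' A) ×ˢ B) =
      ((fibreMeasure F (Fin (n + n)) (thetaOrbitFunctionalReal F E c hcδ hδ hd N e TV hV hVd TW hW hWd ν)
        (thetaOrbitFunctionalReal_nonneg F E c hcδ hδ hd N e TV hV hVd TW hW hWd ν)
        (hNorm F E c hcδ hδ N e TV hVd TW hWd) b).map fr) (A ×ˢ B)) ∧
    ((fibreMeasure F (Fin (n + n)) (thetaOrbitFunctionalReal F E c hcδ hδ hd N e TV hV hVd TW hW hWd ν)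
        (thetaOrbitFunctionalReal_nonneg F E c hcδ hδ hd N e TV hV hVd TW hW hWd ν)
        (hNorm F E c hcδ hδ N e TV hVd TW hWd) b).map fr)
        ({z : (κ → K) × (κ → K) | z.1 ⬝ᵥ z.2 = b' ∧ z.1 ≠ 0 ∧ z.2 ≠ 0}ᶜ ×ˢ (univ : Set Y)) = 0 := by
  set A := vDiagAct F E c hcδ hδ hd N e TV hV hVd TW hW hWd with hA
  let T : GL κ K → ((Fin (n + n) → AdeleRing (𝓞 F) F) ≃ₜ (Fin (n + n) → AdeleRing (𝓞 F) F)) := fun g =>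
    { toEquiv := (A (sel g)).toEquiv
      continuous_toFun := LinearMap.continuous_on_pi (A (sel g)).toLinearMap
      continuous_invFun := LinearMap.continuous_on_pi (A (sel g)).symm.toLinearMap }
  have hTh : ∀ g x, hNorm F E c hcδ hδ N e TV hVd TW hWd (T g x) = hNorm F E c hcδ hδ N e TV hVd TW hWd x :=
    fun g x => hNorm_vDiagAct F E c hcδ hδ hd N e TV hV hVd TW hW hWd (sel g) x
  have hTS : ∀ g, ∀ Φ ∈ piSchwartzBruhat F (Fin (n + n)), Φ ∘ T g ∈ piSchwartzBruhat F (Fin (n + n)) := fun g Φ hΦ => by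
    have hc : Φ ∘ ⇑(T g) = twist F (actTwistGL F A (sel g)) Φ := funext fun x => (twist_actTwistGL F A (sel g) Φ x).symm
    rw [hc]
    exact twist_mem hΦ _
  have hST : ∀ g (Ψ : piSchwartzBruhatReal F (Fin (n + n)))
      (hΨT : (Ψ : (Fin (n + n) → AdeleRing (𝓞 F) F) → ℝ) ∘ T g ∈ piSchwartzBruhatReal F (Fin (n + n))),
      thetaOrbitFunctionalReal F E c hcδ hδ hd N e TV hV hVd TW hW hWd ν
          ⟨(Ψ : (Fin (n + n) → AdeleRing (𝓞 F) F) → ℝ) ∘ T g, hΨT⟩ =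
        thetaOrbitFunctionalReal F E c hcδ hδ hd N e TV hV hVd TW hW hWd ν Ψ := fun g Ψ hΨT =>
    orbitFunctionalReal_comp F (UnitaryGroup.toAdelic F E c N (TV.map (algebraMap F E))).range ν A
      (continuous_vDiagAct_apply F E c hcδ hδ hd N e TV hV hVd TW hW hWd) (vDiagAct_ratPt_of_mem F E c hcδ hδ hd N e TV hV hVd TW hW hWd)
      (sel g) Ψ ⟨_, hΨT⟩ fun _ => rfl
  exact map_fibreMeasure_identityClose_hypotheses F (Fin (n + n)) _ _ _ (continuous_hNorm F E c hcδ hδ N e TV hVd TW hWd)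
    fr b b' hfib T hTh hTS hST (fun g x => hTe g x)

omit [T2Space Y] in
include hfib hTe in
/-- **weighted Lemme-22 form on the theta side**: `∫⁻ f(z) φ(y) d(fr_* μ̂_b) = ĉ(φ) · ∫⁻ f dμ_{b',v}` for every Borel weight `φ ≥ 0` on `Y`
finite against `fr_* μ̂_b` over compacta and every Borel `f ≥ 0`. [cite: Weil1965, Chap. V n° 49 Lemma 22, p. 70; n° 51, p. 73] -/
theorem exists_lintegral_mul_weight_map_fibreMeasure_thetaOrbitFunctionalReal_eq_mul_fibreMeasure (φ : Y → ℝ≥0∞)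
    (hφm : Measurable φ)
    (hφ : ∀ C : Set ((κ → K) × (κ → K)), IsCompact C →
      ∫⁻ z in C ×ˢ (univ : Set Y), φ z.2
        ∂((fibreMeasure F (Fin (n + n)) (thetaOrbitFunctionalReal F E c hcδ hδ hd N e TV hV hVd TW hW hWd ν)
          (thetaOrbitFunctionalReal_nonneg F E c hcδ hδ hd N e TV hV hVd TW hW hWd ν)
          (hNorm F E c hcδ hδ N e TV hVd TW hWd) b).map fr) < ⊤) :
    ∃ cst : ℝ≥0, ∀ f : (κ → K) × (κ → K) → ℝ≥0∞, Measurable f →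
      ∫⁻ z, f z.1 * φ z.2
          ∂((fibreMeasure F (Fin (n + n)) (thetaOrbitFunctionalReal F E c hcδ hδ hd N e TV hV hVd TW hW hWd ν)
            (thetaOrbitFunctionalReal_nonneg F E c hcδ hδ hd N e TV hV hVd TW hW hWd ν)
            (hNorm F E c hcδ hδ N e TV hVd TW hWd) b).map fr) =
        cst * ∫⁻ z, f z ∂(SplitPlace.fibreMeasure μK hκ b') := by
  set A := vDiagAct F E c hcδ hδ hd N e TV hV hVd TW hW hWd with hA
  let T : GL κ K → ((Fin (n + n) → AdeleRing (𝓞 F) F) ≃ₜ (Fin (n + n) → AdeleRing (𝓞 F) F)) := fun g =>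
    { toEquiv := (A (sel g)).toEquiv
      continuous_toFun := LinearMap.continuous_on_pi (A (sel g)).toLinearMap
      continuous_invFun := LinearMap.continuous_on_pi (A (sel g)).symm.toLinearMap }
  have hTh : ∀ g x, hNorm F E c hcδ hδ N e TV hVd TW hWd (T g x) = hNorm F E c hcδ hδ N e TV hVd TW hWd x :=
    fun g x => hNorm_vDiagAct F E c hcδ hδ hd N e TV hV hVd TW hW hWd (sel g) x
  have hTS : ∀ g, ∀ Φ ∈ piSchwartzBruhat F (Fin (n + n)), Φ ∘ T g ∈ piSchwartzBruhat F (Fin (n + n)) := fun g Φ hΦ => by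
    have hc : Φ ∘ ⇑(T g) = twist F (actTwistGL F A (sel g)) Φ := funext fun x => (twist_actTwistGL F A (sel g) Φ x).symm
    rw [hc]
    exact twist_mem hΦ _
  have hST : ∀ g (Ψ : piSchwartzBruhatReal F (Fin (n + n)))
      (hΨT : (Ψ : (Fin (n + n) → AdeleRing (𝓞 F) F) → ℝ) ∘ T g ∈ piSchwartzBruhatReal F (Fin (n + n))),
      thetaOrbitFunctionalReal F E c hcδ hδ hd N e TV hV hVd TW hW hWd ν
          ⟨(Ψ : (Fin (n + n) → AdeleRing (𝓞 F) F) → ℝ) ∘ T g, hΨT⟩ =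
        thetaOrbitFunctionalReal F E c hcδ hδ hd N e TV hV hVd TW hW hWd ν Ψ := fun g Ψ hΨT =>
    orbitFunctionalReal_comp F (UnitaryGroup.toAdelic F E c N (TV.map (algebraMap F E))).range ν A
      (continuous_vDiagAct_apply F E c hcδ hδ hd N e TV hV hVd TW hW hWd) (vDiagAct_ratPt_of_mem F E c hcδ hδ hd N e TV hV hVd TW hW hWd)
      (sel g) Ψ ⟨_, hΨT⟩ fun _ => rfl
  exact exists_lintegral_mul_weight_map_fibreMeasure_eq_mul_fibreMeasure F (Fin (n + n)) _ _ _
    (continuous_hNorm F E c hcδ hδ N e TV hVd TW hWd) μK hκ fr b b' hfib T hTh hTS hST (fun g x => hTe g x) φ hφm hφ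

include hfib hTe in
/-- **rectangles on the theta side**: `(fr_* μ̂_b)(A × B) = ĉ_B · μ_{b',v}(A)` for Borel `A` and relatively compact Borel `B ⊆ Y`.
[cite: Weil1965, Chap. V n° 49 Lemma 22, p. 70; n° 50, pp. 73–74] -/
theorem map_fibreMeasure_thetaOrbitFunctionalReal_prod_eq_mul_fibreMeasure {B : Set Y} (hBm : MeasurableSet B)
    (hBc : IsCompact (closure B)) :
    ∃ cst : ℝ≥0, ∀ A : Set ((κ → K) × (κ → K)), MeasurableSet A →
      ((fibreMeasure F (Fin (n + n)) (thetaOrbitFunctionalReal F E c hcδ hδ hd N e TV hV hVd TW hW hWd ν)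
        (thetaOrbitFunctionalReal_nonneg F E c hcδ hδ hd N e TV hV hVd TW hW hWd ν)
        (hNorm F E c hcδ hδ N e TV hVd TW hWd) b).map fr) (A ×ˢ B) = cst * SplitPlace.fibreMeasure μK hκ b' A := by
  set A := vDiagAct F E c hcδ hδ hd N e TV hV hVd TW hW hWd with hA
  let T : GL κ K → ((Fin (n + n) → AdeleRing (𝓞 F) F) ≃ₜ (Fin (n + n) → AdeleRing (𝓞 F) F)) := fun g =>
    { toEquiv := (A (sel g)).toEquiv
      continuous_toFun := LinearMap.continuous_on_pi (A (sel g)).toLinearMap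
      continuous_invFun := LinearMap.continuous_on_pi (A (sel g)).symm.toLinearMap }
  have hTh : ∀ g x, hNorm F E c hcδ hδ N e TV hVd TW hWd (T g x) = hNorm F E c hcδ hδ N e TV hVd TW hWd x :=
    fun g x => hNorm_vDiagAct F E c hcδ hδ hd N e TV hV hVd TW hW hWd (sel g) x
  have hTS : ∀ g, ∀ Φ ∈ piSchwartzBruhat F (Fin (n + n)), Φ ∘ T g ∈ piSchwartzBruhat F (Fin (n + n)) := fun g Φ hΦ => by
    have hc : Φ ∘ ⇑(T g) = twist F (actTwistGL F A (sel g)) Φ := funext fun x => (twist_actTwistGL F A (sel g) Φ x).symm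
    rw [hc]
    exact twist_mem hΦ _
  have hST : ∀ g (Ψ : piSchwartzBruhatReal F (Fin (n + n)))
      (hΨT : (Ψ : (Fin (n + n) → AdeleRing (𝓞 F) F) → ℝ) ∘ T g ∈ piSchwartzBruhatReal F (Fin (n + n))),
      thetaOrbitFunctionalReal F E c hcδ hδ hd N e TV hV hVd TW hW hWd ν
          ⟨(Ψ : (Fin (n + n) → AdeleRing (𝓞 F) F) → ℝ) ∘ T g, hΨT⟩ =
        thetaOrbitFunctionalReal F E c hcδ hδ hd N e TV hV hVd TW hW hWd ν Ψ := fun g Ψ hΨT =>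
    orbitFunctionalReal_comp F (UnitaryGroup.toAdelic F E c N (TV.map (algebraMap F E))).range ν A
      (continuous_vDiagAct_apply F E c hcδ hδ hd N e TV hV hVd TW hW hWd) (vDiagAct_ratPt_of_mem F E c hcδ hδ hd N e TV hV hVd TW hW hWd)
      (sel g) Ψ ⟨_, hΨT⟩ fun _ => rfl
  exact map_fibreMeasure_prod_eq_mul_fibreMeasure F (Fin (n + n)) _ _ _ (continuous_hNorm F E c hcδ hδ N e TV hVd TW hWd) μK hκ fr b b'
    hfib T hTh hTS hST (fun g x => hTe g x) hBm hBc

end Literature.NumberTheory.Weil1965.UnitaryDoubling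

end
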